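import Summits.CriticalPhenomena.PercolationContinuityZ3.Theorems.PercNearOneGluingAdditiveGluingKernelCornerForm
import Summits.CriticalPhenomena.PercolationContinuityZ3.Theorems.PercNearOneGluingAdditiveGluingSetObserverLemma3
import HarnessLib

/-! # Crux `PercNearOneGluing.AdditiveGluing` (stmt-CriticalPhenomena-4576), line `peel` — the SINGLE-COMPETITOR EXCHANGE
# CERTIFICATE for the block kernel (peel cell, strategy (d) "generalise the certificates", round 2)

Support file (`--supports stmt-CriticalPhenomena-4576`); no definitions, no named facts.

`μ = prodBernoulli u` on the bond configurations of `Fin n`; relays `A ∋ b`; designated relay `a₀`; a block `S ≠ ∅` with cluster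
`K_S = ⋃_{s∈S} C(s)`; `X = ⋃_{s∈S} {a₀ ↔ s}` (`a₀ ∈ K_S`), `Y = ⋃_{s∈S} {s ↔ b}`; dead pockets `W ∩ A = ∅`.  The block kernel
(block goodness, conclusion of `stub_conePeel`, hypothesis `HBLK` of the landed assembly `stub_cone7Assembly_c5`) is
`BG :  μ(a₀↔b) + μ(a₀↮b, X, Y) ≤ μ(Y) + Σ_{W ∩ A = ∅} μ(K_S = W) · min_{a∈A} μ(a ↔ b in Wᶜ)`.

By the conditional normal form (`kernelCorner_threeTerm`, p171235) `BG ⟺ μ(a₀↔b, Xᶜ) ≤ μ(Y ∩ Xᶜ) + (dead-pocket credit)`: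
on `{a₀ ↮ S}` the block must beat the designated relay.  Kozma–Nitzan's Lemma 3(ii) for the SET observer `S`
(`SandwichSet.lemma3_sandwich_set`, p129098, with the sandwich family `𝓕 = {W : a₀ ∉ W}`, i.e. `Q = {a₀ ∉ K_S} = Xᶜ`, decreasing and
determined by the cluster of `a₀`) transports the un-glued minimality `μ(a₀↔b) ≤ μ(a↔b)` of `a₀` to the event `Xᶜ`:
* `exchCert_condHmin`:  `μ(a₀↔b ∩ Xᶜ) ≤ μ(a↔b ∩ Xᶜ)` for every relay `a` with `μ(a₀↔b) ≤ μ(a↔b)` ("conditional hmin");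
* `blockGood_of_exchange` (**exchange certificate**): `BG` follows as soon as ONE competitor `a` with `μ(a₀↔b) ≤ μ(a↔b)` satisfies
  `V_a ≥ 0`, i.e. `μ(a↔b ∩ Xᶜ) ≤ μ(Y ∩ Xᶜ) + Σ_{W∩A=∅} μ(K_S=W)·min_A μ(· ↔ b in Wᶜ)`; so `BG = V_a + slack₃(a)` with
  `slack₃(a) = μ(a↔b ∩ Xᶜ) − μ(a₀↔b ∩ Xᶜ) ≥ 0`.
This is the general-n form of the certificates found by the peel cell's exact n = 6/7 census (lab t12–t13, 2026-08-18): with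
`a = m := argmin_A μ_{u−S}(· ↔ b)` (the whole-block-deletion minimiser) `V_m ≥ 0` in 1158 of 1165 exact drift instances
(all-relay two-hub class 636/640, general blocks 522/525, n = 7 22/22); the 7 exceptions — the coherent-drift core — have `V_a < 0`
for every competitor and are carried by `slack₃(m)` alone.  For `a = a₀` the lemma is `BG` itself; for `A.card ≤ 3` it is the
shape of the landed drift theorem `blockGood_cardLeThree`.
[cite: KozmaNitzan2024, Lemma 3 (pp. 6–7), §3.2 Definition p. 12, Lemma 5 p. 13] [cite: VandenbergHaggstromKahn2005, Thms. 1.3–1.5]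
-/

namespace Summit.CriticalPhenomena.PercolationContinuityZ3.Theorems

open MeasureTheory Set
open Literature.Probability.LatticeModels (prodBernoulli)
open Literature.Probability.Percolation (BondConfig openConn openConnIn openGraph openCluster)
open scoped BigOperators Classical

noncomputable section

section ExchangeCert

open Literature.Probability.LatticeModels Literature.Probability.Percolation

variable {n : ℕ}

/-- The sandwich event `{K_S ∈ {W : a₀ ∉ W}}` of the observer set `S` is the complement of `X = ⋃_{s∈S} {a₀ ↔ s}`. [folklore] -/
theorem exchCert_notAttached_eq (S : Finset (Fin n)) (a₀ : Fin n) :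
    {ω : BondConfig (Fin n) | (⋃ o ∈ S, openCluster ω o) ∈ {W : Set (Fin n) | a₀ ∉ W}}
      = (⋃ s ∈ S, (openConn a₀ s : Set (BondConfig (Fin n))))ᶜ := by
  ext ω
  simp only [Set.mem_setOf_eq, Set.mem_compl_iff]
  rw [SandwichSet.mem_kUnion_iff]
  constructor
  · rintro h hX
    obtain ⟨s, hs, has⟩ := Set.mem_iUnion₂.1 hX
    exact h ⟨s, hs, (show (openGraph ω).Reachable a₀ s from has).symm⟩
  · rintro h ⟨s, hs, hsa⟩
    exact h (Set.mem_iUnion₂.2 ⟨s, hs, (show ω ∈ (openConn a₀ s : Set (BondConfig (Fin n))) from hsa.symm)⟩)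

/-- **Conditional `hmin` on `{a₀ ↮ S}`** (Kozma–Nitzan Lemma 3(ii) for the set observer `S`, sandwich family `{W : a₀ ∉ W}`):
if `μ(a₀↔b) ≤ μ(a↔b)` then `μ(a₀↔b ∩ Xᶜ) ≤ μ(a↔b ∩ Xᶜ)`, `X = ⋃_{s∈S} {a₀↔s}`.
[cite: KozmaNitzan2024, Lemma 3(ii) (pp. 6–7)] [cite: VandenbergHaggstromKahn2005, Thms. 1.3–1.5] -/
theorem exchCert_condHmin (u : Sym2 (Fin n) → unitInterval) (S : Finset (Fin n)) (b a₀ a : Fin n)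
    (hτ : (prodBernoulli u).real (openConn a₀ b) ≤ (prodBernoulli u).real (openConn a b)) :
    (prodBernoulli u).real (openConn a₀ b ∩ (⋃ s ∈ S, openConn a₀ s)ᶜ)
      ≤ (prodBernoulli u).real (openConn a b ∩ (⋃ s ∈ S, openConn a₀ s)ᶜ) := by
  have h := SandwichSet.lemma3_sandwich_set u a₀ a b S {W : Set (Fin n) | a₀ ∉ W}
    (fun ω _ h0 => h0) (fun ω h => h) hτ
  rw [exchCert_notAttached_eq S a₀] at h
  exact h

/-- **Exchange certificate for the block kernel.**  For `S ≠ ∅`, `b ∈ A` and a competitor `a` with `μ(a₀↔b) ≤ μ(a↔b)`: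
if `μ(a↔b ∩ Xᶜ) ≤ μ(Y ∩ Xᶜ) + Σ_{W∩A=∅} μ(K_S=W)·min_{a'∈A} μ(a' ↔ b in Wᶜ)` (`V_a ≥ 0`), then the block `S` is `a₀`-good:
`μ(a₀↔b) + μ(a₀↮b, X, Y) ≤ μ(Y) + Σ_{W∩A=∅} μ(K_S=W)·min_{a'∈A} μ(a' ↔ b in Wᶜ)`.
[cite: KozmaNitzan2024, §3.2 Definition p. 12, Lemma 3 pp. 6–7, Lemma 5 p. 13] -/
theorem blockGood_of_exchange (u : Sym2 (Fin n) → unitInterval) (A S : Finset (Fin n)) (b a₀ a : Fin n)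
    (hb : b ∈ A) (hS : S.Nonempty)
    (hτ : (prodBernoulli u).real (openConn a₀ b) ≤ (prodBernoulli u).real (openConn a b))
    (hV : (prodBernoulli u).real (openConn a b ∩ (⋃ s ∈ S, openConn a₀ s)ᶜ)
      ≤ (prodBernoulli u).real ((⋃ s ∈ S, openConn s b) ∩ (⋃ s ∈ S, openConn a₀ s)ᶜ)
        + ∑ W ∈ (Finset.univ : Finset (Finset (Fin n))).filter (fun W => Disjoint W A),
            (prodBernoulli u).real {ω : BondConfig (Fin n) | ∀ z : Fin n, (z ∈ W ↔ ω ∈ ⋃ s ∈ S, openConn s z)}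
              * A.inf' ⟨b, hb⟩ (fun a' => (prodBernoulli u).real (openConnIn ((W : Set (Fin n))ᶜ) a' b))) :
    (prodBernoulli u).real (openConn a₀ b)
        + (prodBernoulli u).real ((openConn a₀ b)ᶜ ∩ (⋃ s ∈ S, openConn a₀ s) ∩ (⋃ s ∈ S, openConn s b))
      ≤ (prodBernoulli u).real (⋃ s ∈ S, openConn s b)
        + ∑ W ∈ (Finset.univ : Finset (Finset (Fin n))).filter (fun W => Disjoint W A),
            (prodBernoulli u).real {ω : BondConfig (Fin n) | ∀ z : Fin n, (z ∈ W ↔ ω ∈ ⋃ s ∈ S, openConn s z)}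
              * A.inf' ⟨b, hb⟩ (fun a' => (prodBernoulli u).real (openConnIn ((W : Set (Fin n))ᶜ) a' b)) := by
  -- a selection realising the pocketwise minimum
  have hex : ∀ W : Finset (Fin n), ∃ a' ∈ A,
      A.inf' ⟨b, hb⟩ (fun a' => (prodBernoulli u).real (openConnIn ((W : Set (Fin n))ᶜ) a' b))
        = (prodBernoulli u).real (openConnIn ((W : Set (Fin n))ᶜ) a' b) :=
    fun W => Finset.exists_mem_eq_inf' ⟨b, hb⟩ _
  choose sel hselA hselEq using hex
  have hsum : (∑ W ∈ (Finset.univ : Finset (Finset (Fin n))).filter (fun W => Disjoint W A),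
        (prodBernoulli u).real {ω : BondConfig (Fin n) | ∀ z : Fin n, (z ∈ W ↔ ω ∈ ⋃ s ∈ S, openConn s z)}
          * A.inf' ⟨b, hb⟩ (fun a' => (prodBernoulli u).real (openConnIn ((W : Set (Fin n))ᶜ) a' b)))
      = ∑ W ∈ (Finset.univ : Finset (Finset (Fin n))).filter (fun W => Disjoint W A),
        (prodBernoulli u).real {ω : BondConfig (Fin n) | ∀ z : Fin n, (z ∈ W ↔ ω ∈ ⋃ s ∈ S, openConn s z)}
          * (prodBernoulli u).real (openConnIn ((W : Set (Fin n))ᶜ) (sel W) b) :=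
    Finset.sum_congr rfl fun W _ => by rw [hselEq W]
  have h3 := kernelCorner_threeTerm u A S b a₀ sel hS hselA
  have hDE := kernelCorner_pocketSum_eq u A S b sel hS hselA
  have hc := exchCert_condHmin u S b a₀ a hτ
  rw [hsum] at hV ⊢
  linarith

/-- The exchange certificate, ∀-closed (peel cell (d), round 2): `BG(u, A, S, b, a₀)` from one competitor `a` with
`μ(a₀↔b) ≤ μ(a↔b)` and `V_a ≥ 0`. [cite: KozmaNitzan2024, §3.2 Definition p. 12, Lemma 3 pp. 6–7] -/
theorem stub_exchangeCert_pd : ∀ (n : ℕ) (u : Sym2 (Fin n) → unitInterval) (A S : Finset (Fin n)) (b a₀ a : Fin n) (hb : b ∈ A), S.Nonempty → (prodBernoulli u).real (openConn a₀ b) ≤ (prodBernoulli u).real (openConn a b) → (prodBernoulli u).real (openConn a b ∩ (⋃ s ∈ S, openConn a₀ s)ᶜ) ≤ (prodBernoulli u).real ((⋃ s ∈ S, openConn s b) ∩ (⋃ s ∈ S, openConn a₀ s)ᶜ) + (∑ W ∈ (Finset.univ : Finset (Finset (Fin n))).filter (fun W => Disjoint W A), (prodBernoulli u).real {ω : BondConfig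 (Fin n) | ∀ z : Fin n, (z ∈ W ↔ ω ∈ ⋃ s ∈ S, openConn s z)} * A.inf' ⟨b, hb⟩ (fun a' => (prodBernoulli u).real (openConnIn ((W : Set (Fin n))ᶜ) a' b))) → (prodBernoulli u).real (openConn a₀ b) + (prodBernoulli u).real ((openConn a₀ b)ᶜ ∩ (⋃ s ∈ S, openConn a₀ s) ∩ (⋃ s ∈ S, openConn s b)) ≤ (prodBernoulli u).real (⋃ s ∈ S, openConn s b) + (∑ W ∈ (Finset.univ : Finset (Finset (Fin n))).filter (fun W => Disjoint W A), (prodBernoulli u).real {ω : BondConfig (Fin n) | ∀ z : Fin n, (z ∈ W ↔ ω ∈ ⋃ s ∈ S, openConn s z)} * A.inf' ⟨b, hb⟩ (fun a' => (prodBernoulli u).real (openConnIn ((W : Set (Fin n))ᶜ) a' b))) :=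
  fun _ u A S b a₀ a hb hS hτ hV => blockGood_of_exchange u A S b a₀ a hb hS hτ hV

end ExchangeCert

end

end Summit.CriticalPhenomena.PercolationContinuityZ3.Theorems
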